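import Literature.AnabelianGeometry.EtaleTheta.Discharge.Sec2CuspStabModel
import Literature.AnabelianGeometry.EtaleTheta.Discharge.Sec2Prop24ModelCharacteristic
import HarnessLib

/-!
# [EtTh] §1 at the setting: what a CONTINUOUS SECTION of `D_x ↠ G_K` at the cusp buys — (P4) and (P3) of
# `OncePuncturedData` become theorems (proof-only; census note for the 13:00Z v-next of abc-iut-L2-t7's
# `OncePuncturedData`)

Mochizuki, *The étale theta function and its Frobenioid-theoretic manifestations*, Publ. RIMS **45**
(2009), §1 p. 12–13 ("`X^log` … of type `(1,1)`", "the universal graph-covering of the dual graph of this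
special fiber determines … `Π^tp_X ↠ Z` whose kernel … `Π^tp_Y`", "any decomposition group of a cusp of
`Y^log`"), §2 Def. 2.1 p. 35 ("`D_x ⊆ Π_X` … `1 → Δ̄_Θ → D̄_x → G_K → 1`", the cusp is `K`-rational)
[cite: MochizukiEtTh2009, §1 p.13].

Cell abc-iut, layer L2, seat abc-iut-L2-d3 (gen 5). PROOF-ONLY (0 defs). The 13:00Z interface census lists, for
abc-iut-L2-t7's `OncePuncturedData`, the print-shaped datum «`sect x`: a continuous section `s : G_K → D_x` of
`aug`» (GAP-LEDGER G-L2d3-6; consumers: `Sec2SplittingOfSection`, `Sec2CuspStabModel`). This note records, as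
kernel theorems, that such a section makes two EXISTING fields redundant:

* `ThetaSetting.map_aug_decomp_of_section` — (P4) `aug(D_x) = G_K` follows from ANY section;
* `ThetaSetting.decomp_le_ker_toZ_of_section` — (P3) `D_x ≤ Ker(toZ) = Π^tp_Y` follows from a CONTINUOUS section:
  `D_x = I_x · s(G_K)` is compact (`isCompact_decomp_of_section`, Sec2CuspStabModel) and compact subgroups die in
  the discrete torsion-free `Z` (abc-iut-L2's UNCONDITIONAL `le_GtpY_of_isCompact`, Sec2Prop24ModelCharacteristic —
  no L02 needed).

So a v-next `OncePuncturedData` carrying `sect x` may drop (P3)/(P4) or keep them as derived lemmas. HONEST FRAMING: nothing asserts that a section exists for an abstract setting;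
[EtTh] is refereed; no side is taken on [IUTchIII] Cor. 3.12; typed ≠ proved elsewhere.
-/

namespace Literature.AnabelianGeometry.EtaleTheta

open Literature.AnabelianGeometry.SemiGraphs
open _root_.Topology

namespace ThetaSetting

variable {p : ℕ} [Fact p.Prime] (D : ThetaSetting p)

/-- **(P4) from a section**: if `s : G_K → Π^tp_X` takes values in `D_x` and `aug ∘ s = id`, then
`aug(D_x) = G_K`. [cite: MochizukiEtTh2009, Def 2.1 p.35] -/
theorem map_aug_decomp_of_section {x : D.Pt} (s : ↥D.GK →* D.PiTemp) (hs : ∀ σ, s σ ∈ D.decomp x)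
    (hsa : ∀ σ, D.aug (s σ) = (σ : GQp p)) :
    (D.decomp x).map D.aug.toMonoidHom = D.GK := by
  refine le_antisymm ?_ fun σ hσ => ⟨s ⟨σ, hσ⟩, hs _, hsa ⟨σ, hσ⟩⟩
  rintro _ ⟨d, -, rfl⟩
  change D.aug d ∈ D.K.fixingSubgroup
  rw [← D.range_aug]
  exact ⟨d, rfl⟩

/-- **(P3) from a continuous section**: `D_x ≤ Ker(Π^tp_X ↠ Z) = Π^tp_Y` — `D_x = I_x · s(G_K)` is compact
(`isCompact_decomp_of_section`) and compact subgroups lie in `Π^tp_Y` (`le_GtpY_of_isCompact`: `Π^tp_Y` is open and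
`Z` torsion-free). [cite: MochizukiEtTh2009, §1 p.13] -/
theorem decomp_le_ker_toZ_of_section {x : D.Pt} (hx : D.IsCusp x)
    (s : ↥D.GK →* D.PiTemp) (hs : ∀ σ, s σ ∈ D.decomp x) (hsa : ∀ σ, D.aug (s σ) = (σ : GQp p))
    (hsc : Continuous s) : D.decomp x ≤ D.toZ.ker :=
  D.le_GtpY_of_isCompact _ (D.isCompact_decomp_of_section hx s hs hsa hsc)

end ThetaSetting

end Literature.AnabelianGeometry.EtaleTheta
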